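import Summits.QuantumFields.BalabanUV.T4Continuum.Support.ShellMeasureLinearizedFromQ

/-!
# `T4Continuum.ShellMeasureLinearizedKernelSplit` — (LR)_j: THE LINEAR SPLITTING `Ψ : ker LQ̃ × F ≃ E` AND THE
# SECTION OF THE LINEARIZED AVERAGE, CONSTRUCTED FROM A BOUNDED RIGHT INVERSE `h` («LQ̃h = I»)
(cell `pub-balaban`, sub-cell `t4`, spine estimate NE7c (node U5b); NE7c ROUND-2 crew `t4-ne7c-formalise-*`, seat
`b2b-balaban-t4-ne7c-formalise-leaf-05` gen 6; own-initiative leaf on WALL §3 W-d (its analytic half, owner cut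
gen 28, rows S46–S49), journal OFFER «THE `hop`-SIDE OF S46 FOR p. 267's `h`», file 1 of 2; imports leaf-08-g10's
`ShellMeasureLinearizedFromQ` (row S46, p218633) ONLY — hence leaf-09-g8's `ShellMeasureLinearizedRealStructure`
(S40) and the B12 leaves —, all BY NAME; [folklore] linear algebra; 0 `def`, 0 `def … : Prop`, 0 sorry, 0 citations
— the page numbers below LOCATE displayed shapes)

HONEST FRAMING.  Finite four-torus programme, rung (B)+1 only — NOT infinite volume, NOT a mass gap, NOT the Clay
problem, NOT summit progress; (B), `BetaPertHyp`, (B^μ) not consumed.  NE7c (`T4IndicatorShell.ShellWeightBound`) is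
NOT PRINTED and NOT PROVED; «NE7c ⇐ the named binders».  Nothing of [Balaban 1983–89] is asserted.  This file is a
STRUCTURAL JUNCTION: it discharges NO analytic binder of the wall.  It CONSTRUCTS two pieces of DATA that the
curved-fibre-chart ENDs of the (LR)_j road of record take as free binders — the linear splitting
`Ψ : (Kf × F) ≃L[ℝ] E` with «second coordinate = the linearized average» (`(Ψ.symm y).2 = LQ̃ y`, the `hΨ` of
`ShellMeasureLinearizedFromQ.realForm_chartData_of_Q` ∕ `ShellMeasureLinearizedRealStructure.realForm_chartData_fixed`
∕ `ShellMeasureLinearizedRealForm.realForm_chartData`, and the `Ψ`, `σ`, `hσ : (Ψ.symm (σ b)).2 = b` of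
`ShellMeasureLinearizedChart.slotAC_linearizedWindow_of_levelData` ∕ `…Constraint` ∕ `…CondLaw`) — from the ONE
hypothesis print displays: a right inverse `h` of `LQ̃` ([Balaban1987RG1] p. 267 «the operator h satisfies the
identity LQ̃h = I»).  The fibre model is the KERNEL `Kf := ker LQ̃` (print's «new variables» live on the fibres
`{LQ̃ = const}`), the section is `h` itself.  NOTHING in the countdown moves; NE7c NOT PROVED; spine PROVED 0/9.
HONEST DEPENDENCY (cell): continuum YM on T⁴ ⇐ BetaPertH ∧ nine spine estimates (0/9 proved); BetaPertH ⇐ (D1) ∧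
(D4) ∧ CAP+tail; G-an2-4 gates asym, D1 and NE2/3/4.

THE POINT.  Every (LR)_j END in the tree is stated over an abstract splitting `Ψ : (Kf × F) ≃L[ℝ] E` of the block
variables whose second coordinate is the linearized average and over a section `σ` of it; nobody constructs them.
For a bounded linear `T : E → F` with a bounded right inverse `h : F → E` (`T (h f) = f`) the standard splitting is
* §1 `Ψ (k, f) := k + h f` on `ker T × F`, inverse `y ↦ (y − h (T y), T y)`; so `(Ψ.symm y).2 = T y`,
  `Ψ (x, 0) = x`, `Ψ (0, b) = h b`, and `σ := h` is a continuous linear (hence measurable) section with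
  `(Ψ.symm (σ b)).2 = b`, `(Ψ.symm (σ b)).1 = 0`; `T` is onto (`exists_kerSplit`, `exists_kerSplit_section`);
* §1b any MODEL `Kf ≃L[ℝ] ker T` may replace the kernel (`exists_split_of_kerModel`) — for a background-dependent
  `LQ̃_z` the ENDs want ONE fibre type `Kf` for all `z`;
* §2 dimension bookkeeping: `finrank ℝ (ker T) + finrank ℝ F = finrank ℝ E` (`finrank_ker_add`), so the
  engine constant `2(finrank ℝ Kf + …)∕(1−δ)` of the (LR)_j ENDs reads `2(finrank ℝ E − finrank ℝ F + …)∕(1−δ)`;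
  conversely ANY finite-dimensional `Kf` of that dimension carries such a splitting (`exists_split_of_finrank_eq`);
* §3 THE REAL-FORM INSTANCE for row S46: for conjugations `κ_𝒳`, `κ_𝒴` (involutive), a complex CLM
  `LQ : 𝒴 →L[ℂ] 𝒳` and a complex CLM `hop : 𝒳 →L[ℂ] 𝒴` with «LQ̃h = I» and `hop ∘ κ_𝒳 = κ_𝒴 ∘ hop`, the REAL maps
  `T := reP κ_𝒳 ∘ LQ↾ℝ ∘ incl κ_𝒴 : Fix κ_𝒴 → Fix κ_𝒳` and `h := reP κ_𝒴 ∘ hop↾ℝ ∘ incl κ_𝒳` still satisfy `T (h f) = f`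
  (`realLQ_realHop_apply` — `incl_reP_of_fixed`, `reP_incl`, `conj_incl` BY NAME; NO reality hypothesis on `LQ` is
  needed), hence the splitting `Ψ : (ker T × Fix κ_𝒳) ≃L[ℝ] Fix κ_𝒴` with S46's `hΨ` LITERALLY
  (`exists_realForm_kerSplit`);
* §4 COROLLARY **`exists_realForm_chartData_of_Q_ker`** = `ShellMeasureLinearizedFromQ.exists_realForm_chartData_of_Q`
  with the binders `Kf`, `Ψ`, `hΨ` GONE (`Kf := ker T`, `Ψ` from §3): from (Q1)–(Q4) + `hop` ALONE there are `D̃`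
  and the real chart with the four clauses, clause (iv) now reading «the real average of the substituted field IS
  the real `LQ̃B`» (print: «LQ̃B′ + C̃(B′) = … = LQ̃B»).
* §5 NON-VACUITY of §1's hypothesis: `E = ℝ × ℝ`, `F = ℝ`, `T = snd`, `h = inr`.
WHICH END ∕ BINDER: supplies the DATA binders `Ψ`∕`hΨ` of S46∕S40∕S36 and `Ψ`∕`σ`∕`hσ` of S33 (RULING T-NE7c-8, the
(LR)_j reading of record); mints nothing (trigger c2); for the PRINTED average (2.4)∕[B7] (15) the remaining inputs
are rows S47 (Q4), S48 («LQ̃h = I» for the Fréchet derivative), S49 (Q1)–(Q3) and file 2 of this offer (`hop`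
complex-linear and ⋆-equivariant).  NOTHING in the countdown moves.
-/

noncomputable section

open Set Metric Filter Topology

namespace Summit.QuantumFields.BalabanUV.T4Continuum.ShellMeasureLinearizedKernelSplit

open Literature.MathematicalPhysics.QuantumFieldTheory.Balaban1983to89
open Summit.QuantumFields.BalabanUV.Beta.LinearizingChange267FromQ (nonlin Mq)
open ShellMeasureLinearizedRealStructure (realSub incl reP incl_reP_of_fixed conj_incl reP_incl)
open ShellMeasureLinearizedFromQ (exists_realForm_chartData_of_Q)

/-! ## §1 The splitting `ker T × F ≃ E` of a bounded operator with a bounded right inverse -/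

section Generic

variable {E F : Type*} [NormedAddCommGroup E] [NormedSpace ℝ E] [NormedAddCommGroup F] [NormedSpace ℝ F]
  {T : E →L[ℝ] F} {h : F →L[ℝ] E}

/-- a right-invertible operator is ONTO. [folklore] -/
theorem surjective_of_rightInverse (hTh : ∀ f, T (h f) = f) : Function.Surjective T :=
  fun f => ⟨h f, hTh f⟩

/-- **THE SPLITTING FROM A RIGHT INVERSE.**  For a bounded `T : E → F` with a bounded right inverse `h`
(`T (h f) = f`) there is a continuous linear isomorphism `Ψ : (ker T × F) ≃ E`, `Ψ (k, f) = k + h f`, whose inverse is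
`y ↦ (y − h (T y), T y)` (Mathlib's `ContinuousLinearEquiv.equivOfRightInverse`, coordinates swapped): in particular
its SECOND COORDINATE IS `T` (`(Ψ.symm y).2 = T y` — the binder `hΨ` of the (LR)_j ENDs), the kernel sits inside as
`Ψ (x, 0) = x`, and `Ψ (0, b) = h b`. [folklore] -/
theorem exists_kerSplit (hTh : ∀ f, T (h f) = f) :
    ∃ Ψ : (T.ker × F) ≃L[ℝ] E,
      (∀ p, Ψ p = (p.1 : E) + h p.2) ∧ (∀ y, (Ψ.symm y).2 = T y) ∧
      (∀ y, ((Ψ.symm y).1 : E) = y - h (T y)) ∧ (∀ x : T.ker, Ψ (x, 0) = x) ∧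
      (∀ b, Ψ (0, b) = h b) := by
  refine ⟨((ContinuousLinearEquiv.equivOfRightInverse T h hTh).trans
    (ContinuousLinearEquiv.prodComm ℝ F T.ker)).symm,
    fun p => ?_, fun y => ?_, fun y => ?_, fun x => ?_, fun b => ?_⟩
  · rw [ContinuousLinearEquiv.symm_trans_apply, ContinuousLinearEquiv.prodComm_symm,
      ContinuousLinearEquiv.prodComm_apply, Prod.swap_prod_mk, ContinuousLinearEquiv.equivOfRightInverse_symm_apply,
      add_comm]
  · rw [ContinuousLinearEquiv.symm_symm, ContinuousLinearEquiv.trans_apply, ContinuousLinearEquiv.prodComm_apply,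
      Prod.snd_swap, ContinuousLinearEquiv.fst_equivOfRightInverse]
  · rw [ContinuousLinearEquiv.symm_symm, ContinuousLinearEquiv.trans_apply, ContinuousLinearEquiv.prodComm_apply,
      Prod.fst_swap, ContinuousLinearEquiv.snd_equivOfRightInverse]
  · rw [ContinuousLinearEquiv.symm_trans_apply, ContinuousLinearEquiv.prodComm_symm,
      ContinuousLinearEquiv.prodComm_apply, Prod.swap_prod_mk, ContinuousLinearEquiv.equivOfRightInverse_symm_apply,
      map_zero, zero_add]
  · rw [ContinuousLinearEquiv.symm_trans_apply, ContinuousLinearEquiv.prodComm_symm,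
      ContinuousLinearEquiv.prodComm_apply, Prod.swap_prod_mk, ContinuousLinearEquiv.equivOfRightInverse_symm_apply,
      ZeroMemClass.coe_zero, add_zero]

/-- **THE SECTION.**  With the splitting of `exists_kerSplit`, `σ := h` is a continuous linear — hence measurable —
section of the second coordinate: `(Ψ.symm (σ b)).2 = b` (the binder `hσ` of
`ShellMeasureLinearizedChart.slotAC_linearizedWindow_of_levelData`), with first coordinate `0` («centre at the
section value»), and `σ b + Ψ (x, 0) = Ψ (x, b)` (the END's chart point). [folklore] -/
theorem exists_kerSplit_section [MeasurableSpace F] [OpensMeasurableSpace F] [MeasurableSpace E] [BorelSpace E]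
    (hTh : ∀ f, T (h f) = f) :
    ∃ Ψ : (T.ker × F) ≃L[ℝ] E,
      (∀ p, Ψ p = (p.1 : E) + h p.2) ∧ (∀ y, (Ψ.symm y).2 = T y) ∧
      Measurable (h : F → E) ∧ (∀ b, (Ψ.symm (h b)).2 = b) ∧ (∀ b, ((Ψ.symm (h b)).1 : E) = 0) ∧
      (∀ x : T.ker, ∀ b, h b + Ψ (x, 0) = Ψ (x, b)) := by
  obtain ⟨Ψ, hΨ, hΨ2, hΨ1, hΨx, -⟩ := exists_kerSplit hTh
  refine ⟨Ψ, hΨ, hΨ2, h.continuous.measurable, fun b => by rw [hΨ2, hTh], fun b => by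
    rw [hΨ1, hTh, sub_self], fun x b => by rw [hΨx, hΨ, add_comm]⟩

/-- **ANY KERNEL MODEL WILL DO.**  If `Kf` is a real normed space with a continuous linear isomorphism
`e : Kf ≃ ker T` (e.g. ONE fibre type for a background-dependent family `LQ̃_z`, all kernels having the same
dimension), the splitting transports: `Ψ (x, f) = e x + h f`, `(Ψ.symm y).2 = T y`. [folklore] -/
theorem exists_split_of_kerModel {Kf : Type*} [NormedAddCommGroup Kf] [NormedSpace ℝ Kf]
    (e : Kf ≃L[ℝ] T.ker) (hTh : ∀ f, T (h f) = f) :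
    ∃ Ψ : (Kf × F) ≃L[ℝ] E,
      (∀ p, Ψ p = (e p.1 : E) + h p.2) ∧ (∀ y, (Ψ.symm y).2 = T y) ∧ (∀ b, (Ψ.symm (h b)).2 = b) := by
  obtain ⟨Ψ₀, hΨ₀, hΨ₀2, -, -, -⟩ := exists_kerSplit hTh
  have h2 : ∀ y, (((e.prodCongr (ContinuousLinearEquiv.refl ℝ F)).trans Ψ₀).symm y).2 = T y := fun y => by
    rw [ContinuousLinearEquiv.symm_trans_apply, ContinuousLinearEquiv.prodCongr_symm,
      ContinuousLinearEquiv.prodCongr_apply, ContinuousLinearEquiv.refl_symm, ContinuousLinearEquiv.coe_refl', id_eq,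
      hΨ₀2]
  refine ⟨(e.prodCongr (ContinuousLinearEquiv.refl ℝ F)).trans Ψ₀, fun p => ?_, h2, fun b => by rw [h2, hTh]⟩
  rw [ContinuousLinearEquiv.trans_apply, ContinuousLinearEquiv.prodCongr_apply, ContinuousLinearEquiv.coe_refl',
    id_eq, hΨ₀]

/-! ## §2 Dimension bookkeeping: `finrank (ker T) + finrank F = finrank E` -/

/-- a right-invertible operator out of a finite-dimensional space has a finite-dimensional target. [folklore] -/
theorem finiteDimensional_of_rightInverse [FiniteDimensional ℝ E] (hTh : ∀ f, T (h f) = f) :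
    FiniteDimensional ℝ F :=
  Module.Finite.of_surjective (T : E →ₗ[ℝ] F) (surjective_of_rightInverse hTh)

/-- **RANK–NULLITY FOR THE SPLITTING**: `finrank ℝ (ker T) + finrank ℝ F = finrank ℝ E` — the fibre dimension entering
the (LR)_j engine constant `2(finrank ℝ Kf + …)∕(1−δ)` is `finrank ℝ E − finrank ℝ F`. [folklore] -/
theorem finrank_ker_add [FiniteDimensional ℝ E] (hTh : ∀ f, T (h f) = f) :
    Module.finrank ℝ T.ker + Module.finrank ℝ F = Module.finrank ℝ E := by
  have hr : LinearMap.range (T : E →ₗ[ℝ] F) = ⊤ := LinearMap.range_eq_top.2 (surjective_of_rightInverse hTh)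
  have h1 := LinearMap.finrank_range_add_finrank_ker (T : E →ₗ[ℝ] F)
  rw [hr, finrank_top] at h1
  rw [add_comm]
  exact h1

/-- the same as a subtraction in `ℕ`. [folklore] -/
theorem finrank_ker_eq_sub [FiniteDimensional ℝ E] (hTh : ∀ f, T (h f) = f) :
    Module.finrank ℝ T.ker = Module.finrank ℝ E - Module.finrank ℝ F := by
  have := finrank_ker_add hTh
  omega

/-- **ONE FIBRE TYPE OF THE RIGHT DIMENSION SUFFICES**: any finite-dimensional real normed space `Kf` with
`finrank ℝ Kf = finrank ℝ E − finrank ℝ F` carries a splitting `Ψ : (Kf × F) ≃ E` with second coordinate `T` and section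
`h` (a model isomorphism `Kf ≃ ker T` exists by `ContinuousLinearEquiv.ofFinrankEq`; for a background-dependent family
`T_z` this gives `Ψ z` for each `z` separately — no measurability in `z` is asserted). [folklore] -/
theorem exists_split_of_finrank_eq {Kf : Type*} [NormedAddCommGroup Kf] [NormedSpace ℝ Kf] [FiniteDimensional ℝ Kf]
    [FiniteDimensional ℝ E] (hTh : ∀ f, T (h f) = f)
    (hdim : Module.finrank ℝ Kf = Module.finrank ℝ E - Module.finrank ℝ F) :
    ∃ Ψ : (Kf × F) ≃L[ℝ] E, (∀ y, (Ψ.symm y).2 = T y) ∧ (∀ b, (Ψ.symm (h b)).2 = b) := by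
  have e : Kf ≃L[ℝ] T.ker := ContinuousLinearEquiv.ofFinrankEq (by rw [hdim, finrank_ker_eq_sub hTh])
  obtain ⟨Ψ, -, h2, h3⟩ := exists_split_of_kerModel e hTh
  exact ⟨Ψ, h2, h3⟩

end Generic

/-! ## §3 The real-form instance: S46's real `LQ̃` and real `h` -/

section RealForm

variable {𝒳 𝒴 : Type*} [NormedAddCommGroup 𝒳] [NormedSpace ℂ 𝒳] [NormedAddCommGroup 𝒴] [NormedSpace ℂ 𝒴]
  {κX : 𝒳 ≃ₗᵢ⋆[ℂ] 𝒳} {κY : 𝒴 ≃ₗᵢ⋆[ℂ] 𝒴}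

/-- an equivariant `hop` maps REAL fields to REAL fields: `κ_𝒳 X = X → κ_𝒴 (hop X) = hop X`. [folklore] -/
theorem conj_hop_of_fixed {hopC : 𝒳 →L[ℂ] 𝒴} (hhop : ∀ X, hopC (κX X) = κY (hopC X)) {X : 𝒳} (hX : κX X = X) :
    κY (hopC X) = hopC X := by
  rw [← hhop, hX]

/-- **THE REAL `h` IS A RIGHT INVERSE OF THE REAL `LQ̃`.**  For INVOLUTIVE conjugations, a complex CLM `LQ` with
complex right inverse `hopC` («LQ̃h = I») that is `κ`-EQUIVARIANT, the real maps
`T := reP κ_𝒳 ∘ LQ↾ℝ ∘ incl κ_𝒴` and `h := reP κ_𝒴 ∘ hopC↾ℝ ∘ incl κ_𝒳` satisfy `T (h f) = f` — no reality hypothesis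
on `LQ` is used (`hop` of a real field is real, and `LQ̃h = I` then holds before projecting). [folklore] -/
theorem realLQ_realHop_apply (hκX : ∀ X, κX (κX X) = X) (hκY : ∀ B, κY (κY B) = B) {LQ : 𝒴 →L[ℂ] 𝒳}
    {hopC : 𝒳 →L[ℂ] 𝒴} (hLQh : ∀ X, LQ (hopC X) = X) (hhop : ∀ X, hopC (κX X) = κY (hopC X))
    (f : realSub κX) :
    (reP κX hκX ∘L LQ.restrictScalars ℝ ∘L incl κY) ((reP κY hκY ∘L hopC.restrictScalars ℝ ∘L incl κX) f) = f := by
  simp only [ContinuousLinearMap.coe_comp, Function.comp_apply, ContinuousLinearMap.coe_restrictScalars']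
  rw [incl_reP_of_fixed hκY _ (conj_hop_of_fixed hhop (conj_incl κX f)), hLQh, reP_incl]

/-- **THE REAL-FORM SPLITTING FOR ROW S46** — its binders `Ψ`, `hΨ` CONSTRUCTED with `Kf := ker T`: there is
`Ψ : (ker T × Fix κ_𝒳) ≃L[ℝ] Fix κ_𝒴` with `(Ψ.symm y).2 = (reP κ_𝒳 ∘L LQ↾ℝ ∘L incl κ_𝒴) y` LITERALLY, `Ψ (x, 0) = x`,
and the real `h` as section. [folklore] -/
theorem exists_realForm_kerSplit (hκX : ∀ X, κX (κX X) = X) (hκY : ∀ B, κY (κY B) = B) {LQ : 𝒴 →L[ℂ] 𝒳}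
    {hopC : 𝒳 →L[ℂ] 𝒴} (hLQh : ∀ X, LQ (hopC X) = X) (hhop : ∀ X, hopC (κX X) = κY (hopC X)) :
    ∃ Ψ : ((reP κX hκX ∘L LQ.restrictScalars ℝ ∘L incl κY).ker × realSub κX) ≃L[ℝ] realSub κY,
      (∀ p, Ψ p = (p.1 : realSub κY) + (reP κY hκY ∘L hopC.restrictScalars ℝ ∘L incl κX) p.2) ∧
      (∀ y, (Ψ.symm y).2 = (reP κX hκX ∘L LQ.restrictScalars ℝ ∘L incl κY) y) ∧
      (∀ x, Ψ (x, 0) = x) ∧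
      (∀ b, (Ψ.symm ((reP κY hκY ∘L hopC.restrictScalars ℝ ∘L incl κX) b)).2 = b) := by
  obtain ⟨Ψ, hΨ, hΨ2, -, hΨx, -⟩ := exists_kerSplit (realLQ_realHop_apply hκX hκY hLQh hhop)
  exact ⟨Ψ, hΨ, hΨ2, hΨx, fun b => by rw [hΨ2, realLQ_realHop_apply hκX hκY hLQh hhop]⟩

/-- the fibre dimension of the real form: `finrank ℝ (ker T) + finrank ℝ (Fix κ_𝒳) = finrank ℝ (Fix κ_𝒴)`
(`= finrank ℂ 𝒴` by `ShellMeasureLinearizedRealStructure.finrank_realSub`). [folklore] -/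
theorem finrank_ker_realLQ_add [FiniteDimensional ℂ 𝒴] (hκX : ∀ X, κX (κX X) = X) (hκY : ∀ B, κY (κY B) = B)
    {LQ : 𝒴 →L[ℂ] 𝒳} {hopC : 𝒳 →L[ℂ] 𝒴} (hLQh : ∀ X, LQ (hopC X) = X)
    (hhop : ∀ X, hopC (κX X) = κY (hopC X)) :
    Module.finrank ℝ ((reP κX hκX ∘L LQ.restrictScalars ℝ ∘L incl κY).ker) +
      Module.finrank ℝ (realSub κX) = Module.finrank ℝ (realSub κY) := by
  haveI : FiniteDimensional ℝ 𝒴 := FiniteDimensional.complexToReal 𝒴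
  exact finrank_ker_add (realLQ_realHop_apply hκX hκY hLQh hhop)

end RealForm

/-! ## §4 Corollary: S46's END with the splitting binders gone -/

section Junction

variable {𝒳 𝒴 : Type*} [NormedAddCommGroup 𝒳] [NormedSpace ℂ 𝒳] [NormedAddCommGroup 𝒴] [NormedSpace ℂ 𝒴]
  [CompleteSpace 𝒳] [CompleteSpace 𝒴]
  {Qt : 𝒴 → 𝒳} {R MQ b ε : ℝ} {hop : 𝒳 →ₗ[ℂ] 𝒴} {κX : 𝒳 ≃ₗᵢ⋆[ℂ] 𝒳} {κY : 𝒴 ≃ₗᵢ⋆[ℂ] 𝒴}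

/-- **THE REAL-FORM LINEARIZING CHART DATA FROM `Q̃` ALONE, FIBRE MODEL = THE KERNEL** —
`ShellMeasureLinearizedFromQ.exists_realForm_chartData_of_Q` with `Kf := ker T`
(`T := reP κ_𝒳 ∘ LQ̃↾ℝ ∘ incl κ_𝒴` the real linearized average, `LQ̃ := fderiv ℂ Qt 0`) and the splitting `Ψ`, `hΨ` of
§3 SUPPLIED: from (Q1)–(Q4), the involutive conjugations, the equivariant bounded right inverse `hop` and the window
numerics ALONE there are `D̃` (in the ball `4·(Mq R M_Q)·ε²`, solving print's fixed-point equation, linearizing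
`Q̃`) and the real chart `B ↦ B − h (D̃_ℝ B)` which is MEASURABLE, INJECTIVE on the real window, DIFFERENTIABLE within
it, and LINEARIZES the real average: clause (iv) reads `T(chart B) + C̃_ℝ(chart B) = T B` («LQ̃B′ + C̃(B′) = LQ̃B»,
p. 267). [folklore] -/
theorem exists_realForm_chartData_of_Q_ker [MeasurableSpace 𝒴] [BorelSpace 𝒴] [FiniteDimensional ℂ 𝒴]
    [MeasurableSpace 𝒳] [BorelSpace 𝒳] (hκX : ∀ X, κX (κX X) = X) (hκY : ∀ B, κY (κY B) = B)
    (hR : 0 < R) (hQa : AnalyticOnNhd ℂ Qt (ball 0 R)) (hQ0 : Qt 0 = 0)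
    (hQM : ∀ B ∈ ball (0 : 𝒴) R, ‖Qt B‖ ≤ MQ) (hQt : ∀ B ∈ ball (0 : 𝒴) R, Qt (κY B) = κX (Qt B))
    (hLQh : ∀ X, fderiv ℂ Qt 0 (hop X) = X) (hb : 0 ≤ b) (hHop : ∀ X, ‖hop X‖ ≤ b * ‖X‖)
    (hhop : ∀ X, hop (κX X) = κY (hop X)) (hq : 9 * Mq R MQ * b * ε < 1) (hRC : 3 * ε ≤ R) :
    ∃ Dt : 𝒴 → 𝒳,
      (∀ B : 𝒴, ‖B‖ < ε → Dt B ∈ closedBall (0 : 𝒳) (4 * Mq R MQ * ε ^ 2) ∧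
        nonlin Qt (B - hop (Dt B)) = Dt B ∧ Qt (B - hop (Dt B)) = fderiv ℂ Qt 0 B) ∧
      Measurable (fun B : realSub κY => B - (reP κY hκY ∘L (hop.mkContinuous b hHop).restrictScalars ℝ ∘L
          incl κX) (({y : realSub κY | ‖incl κY y‖ < ε}).piecewise
            (fun y => reP κX hκX (Dt (incl κY y))) 0 B)) ∧
      InjOn (fun B : realSub κY => B - (reP κY hκY ∘L (hop.mkContinuous b hHop).restrictScalars ℝ ∘L
          incl κX) (({y : realSub κY | ‖incl κY y‖ < ε}).piecewise
            (fun y => reP κX hκX (Dt (incl κY y))) 0 B))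
          {y : realSub κY | ‖incl κY y‖ < ε} ∧
      (∀ B ∈ {y : realSub κY | ‖incl κY y‖ < ε}, HasFDerivWithinAt
          (fun B : realSub κY => B - (reP κY hκY ∘L (hop.mkContinuous b hHop).restrictScalars ℝ ∘L
            incl κX) (({y : realSub κY | ‖incl κY y‖ < ε}).piecewise
              (fun y => reP κX hκX (Dt (incl κY y))) 0 B))
          (ContinuousLinearMap.id ℝ (realSub κY) - (reP κY hκY ∘L (hop.mkContinuous b hHop).restrictScalars ℝ ∘L
            incl κX).comp (reP κX hκX ∘L (fderiv ℂ Dt (incl κY B)).restrictScalars ℝ ∘L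
              incl κY)) {y : realSub κY | ‖incl κY y‖ < ε} B) ∧
      ∀ B ∈ {y : realSub κY | ‖incl κY y‖ < ε},
          (reP κX hκX ∘L (fderiv ℂ Qt 0).restrictScalars ℝ ∘L incl κY) (B - (reP κY hκY ∘L
              (hop.mkContinuous b hHop).restrictScalars ℝ ∘L incl κX)
              (({y : realSub κY | ‖incl κY y‖ < ε}).piecewise
                (fun y => reP κX hκX (Dt (incl κY y))) 0 B)) +
            (fun y => reP κX hκX (nonlin Qt (incl κY y))) (B - (reP κY hκY ∘L
              (hop.mkContinuous b hHop).restrictScalars ℝ ∘L incl κX)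
              (({y : realSub κY | ‖incl κY y‖ < ε}).piecewise
                (fun y => reP κX hκX (Dt (incl κY y))) 0 B)) =
            (reP κX hκX ∘L (fderiv ℂ Qt 0).restrictScalars ℝ ∘L incl κY) B := by
  have hLQh' : ∀ X, fderiv ℂ Qt 0 ((hop.mkContinuous b hHop) X) = X := fun X => hLQh X
  have hhop' : ∀ X, (hop.mkContinuous b hHop) (κX X) = κY ((hop.mkContinuous b hHop) X) := fun X => hhop X
  obtain ⟨Ψ, -, hΨ2, -, -⟩ := exists_realForm_kerSplit hκX hκY hLQh' hhop'
  obtain ⟨Dt, hD, h1, h2, h3, h4⟩ :=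
    exists_realForm_chartData_of_Q hκX hκY hR hQa hQ0 hQM hQt hLQh hb hHop hhop hq hRC Ψ hΨ2
  exact ⟨Dt, hD, h1, h2, h3, fun B hB => by rw [h4 B hB, hΨ2]⟩

end Junction

/-! ## §5 Non-vacuity of §1's hypothesis -/

/-- The hypothesis «bounded right inverse» of §1 is inhabited non-trivially: `E = ℝ × ℝ`, `F = ℝ`, `T = snd`,
`h = inr` (`T (h f) = f`, kernel = the first axis); a TOY about the binder SHAPE only (c3). [folklore] -/
example : ∃ (T : (ℝ × ℝ) →L[ℝ] ℝ) (h : ℝ →L[ℝ] (ℝ × ℝ)), (∀ f, T (h f) = f) ∧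
    ∃ Ψ : (T.ker × ℝ) ≃L[ℝ] (ℝ × ℝ), ∀ y, (Ψ.symm y).2 = T y := by
  refine ⟨ContinuousLinearMap.snd ℝ ℝ ℝ, ContinuousLinearMap.inr ℝ ℝ ℝ, fun f => rfl, ?_⟩
  obtain ⟨Ψ, -, hΨ2, -⟩ := exists_kerSplit (T := ContinuousLinearMap.snd ℝ ℝ ℝ)
    (h := ContinuousLinearMap.inr ℝ ℝ ℝ) (fun f => rfl)
  exact ⟨Ψ, hΨ2⟩

end Summit.QuantumFields.BalabanUV.T4Continuum.ShellMeasureLinearizedKernelSplit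

end
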